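import Literature.NumberTheory.Automorphic.ArchPullbackCalculus
import Literature.NumberTheory.Automorphic.TestFunctionLieDeriv
import Literature.NumberTheory.Automorphic.AutomorphicTwistNorm
import Literature.NumberTheory.Automorphic.AutomorphicRepDataSplitCenter
import Literature.NumberTheory.Automorphic.AutomorphicFormsGLContinuous
import Literature.NumberTheory.Automorphic.AdelicHeightGLSiegel
import Literature.NumberTheory.Automorphic.WhittakerTower
import HarnessLib

/-!
# Reduction of a cusp form to an `A_G`-invariant cusp form agreeing with it on a determinant slice
# `{g : |det g|_𝔸 = |det x₀|_𝔸}`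

Topic `NumberTheory/Automorphic`; namespace `Literature.NumberTheory.Automorphic`. For `GL_n`
(`n ≥ 1`) over a number field `K`, the split component `A_G = ℝ_{>0}` (`posRealScalar`, positive
real scalar matrices at the archimedean places) satisfies `|det a|_𝔸 = a^{n[K:ℚ]}`
(`ideleNorm_det_posRealScalar`), so every `g ∈ GL_n(𝔸_K)` is `A_G`-equivalent to exactly one point of
the slice `|det| = |det x₀|`, namely `r_{x₀}(g) = g · a(g)⁻¹`, `a(g) = (|det g| / |det x₀|)^{1/n[K:ℚ]}`
(`sliceScale`, `sliceRetraction`). For `φ : GL_n(𝔸_K) → ℂ` the pull-back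
`φ♭ = sliceExtend x₀ φ = φ ∘ r_{x₀}` is the unique `A_G`-invariant function agreeing with `φ` on the
slice. We PROVE:

* `sliceRetraction_mul_of_detNormUnit_eq_one`, `sliceExtend_apply_of_detNormUnit_eq`,
  `sliceExtend_posRealScalar_mul` — `r(g h) = r(g) h` if `|det h| = 1`, `φ♭ = φ` on the slice,
  `φ♭(a g) = φ♭(g)` for `a ∈ A_G`;
* `exists_sliceRetraction_mul_glArch_expMem` — the intertwining identity
  `r(g · exp X) = r(g) · exp(X - λ(X)/(n[K:ℚ]) · 1)` with `|det (exp X, 1)|_𝔸 = e^{λ(X)}`, the input of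
  `ArchPullbackCalculus`;
* `isCuspFormGL_sliceExtend` — **if `φ` is a cusp form then so is `φ♭`** (Borel–Jacquet (1979),
  4.2 (a)–(d) and 4.4: left invariance and level by `|det γ| = |det u| = 1`; smoothness,
  `Z(𝔤)`- and `K_∞`-finiteness by `ArchPullbackCalculus` — `λ/(n[K:ℚ])` kills brackets and `1` is
  central in `𝔤`, `|det k|_𝔸 = 1` on `K_∞`; moderate growth by the height bounds for `|det|^{±1}` and
  for `A_G`; cuspidality because `r(u g) = u r(g)` for unipotent `u`);
* `whittakerDepth_sliceExtend_eq` — the partial Whittaker transforms of `φ♭` and `φ` agree on the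
  slice (the unipotent variables have determinant one).

This is the standard reduction of statements about arbitrary cusp forms (no central character
assumed) to the `A_G`-invariant case, in which the tree PROVES Harish-Chandra's uniform moderate
growth (`IsCuspFormGL.hasUniformModerateGrowth_of_center'`): Moeglin–Waldspurger (1995), I.2.3,
I.3.2; Borel–Jacquet (1979), 5.7. The definitions `sliceScale`, `sliceRetraction`, `sliceExtend`
come with unfolding lemmas; everything else is a theorem.

## References

* A. Borel, H. Jacquet, *Automorphic forms and automorphic representations*, Proc. Sympos. Pure
  Math. 33 (1979), part 1, 4.2, 4.4, 5.7 [BorelJacquet1979].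
* C. Moeglin, J.-L. Waldspurger, *Spectral decomposition and Eisenstein series* (1995), I.2.3, I.3.2
  [MoeglinWaldspurger1995].
-/

noncomputable section

-- Mathlib idiom (Mathlib/Algebra/Lie/OfAssociative.lean); needed to mention Lie subalgebras of matrix algebras
attribute [local instance 100] LieRing.ofAssociativeRing

open MeasureTheory NumberField NumberField.mixedEmbedding NumberField.InfinitePlace IsDedekindDomain Matrix Set
  Filter Topology
open scoped MatrixGroups Classical NNReal

namespace Literature.NumberTheory.Automorphic

variable {n : ℕ} {K : Type} [Field K] [NumberField K]

/-! ### The determinant norm and the `A_G`-coordinate -/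

section Scale

variable (n K)

/-- **The idelic norm of the determinant, `g ↦ |det g|_𝔸 ∈ ℝ_{>0}`**, as a homomorphism
`GL_n(𝔸_K) →* ℝ≥0ˣ`. [folklore] -/
def detNormUnit : GL (Fin n) (AdeleRing (𝓞 K) K) →* ℝ≥0ˣ :=
  ((IdeleClassGroup.ideleNorm K).comp Matrix.GeneralLinearGroup.det).toHomUnits

variable {n K}

/-- Unfolding: `(detNormUnit g : ℝ≥0) = |det g|_𝔸`. [folklore] -/
theorem coe_detNormUnit (g : GL (Fin n) (AdeleRing (𝓞 K) K)) :
    ((detNormUnit n K g : ℝ≥0ˣ) : ℝ≥0) = IdeleClassGroup.ideleNorm K (Matrix.GeneralLinearGroup.det g) := rfl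

/-- `(detNormUnit g : ℝ) = ideleNorm (det g)`. [folklore] -/
theorem coe_coe_detNormUnit (g : GL (Fin n) (AdeleRing (𝓞 K) K)) :
    (((detNormUnit n K g : ℝ≥0ˣ) : ℝ≥0) : ℝ) = GaloisRepresentations.ideleNorm (Matrix.GeneralLinearGroup.det g) := by
  rw [coe_detNormUnit, coe_ideleNorm]

/-- **`|det a|_𝔸 = a^{n[K:ℚ]}` on `A_G`.** [folklore] -/
theorem detNormUnit_posRealScalar (t : ℝ≥0ˣ) :
    detNormUnit n K (posRealScalar n K t) = t ^ (n * Module.finrank ℚ K) := by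
  refine Units.ext ?_
  rw [coe_detNormUnit, ideleNorm_det_posRealScalar, Units.val_pow_eq_pow_val]

/-- `|det γ|_𝔸 = 1` for `γ ∈ GL_n(K)` (product formula). [folklore] -/
theorem detNormUnit_eq_one_of_mem_arithmeticSubgroup {γ : GL (Fin n) (AdeleRing (𝓞 K) K)}
    (hγ : γ ∈ (AdelicGroupData.gl n K).arithmeticSubgroup) : detNormUnit n K γ = 1 := by
  obtain ⟨γ₀, rfl⟩ := hγ
  refine Units.ext (NNReal.coe_injective ?_)
  rw [coe_coe_detNormUnit, Units.val_one, NNReal.coe_one]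
  exact GaloisRepresentations.ideleNorm_eq_one_of_mem_principalIdeles (GLn.det_toAdelic_mem_principalIdeles n γ₀)

/-- `|det u|_𝔸 = 1` on every admissible level `U`. [folklore] -/
theorem detNormUnit_eq_one_of_mem_finiteLevelsGL {U : Subgroup (GL (Fin n) (AdeleRing (𝓞 K) K))}
    (hU : U ∈ finiteLevelsGL n K) {u : GL (Fin n) (AdeleRing (𝓞 K) K)} (hu : u ∈ U) : detNormUnit n K u = 1 := by
  obtain ⟨U₀, -, hU₀c, rfl⟩ := hU
  obtain ⟨u₀, hu₀, rfl⟩ := hu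
  refine Units.ext ?_
  rw [coe_detNormUnit, Units.val_one]
  exact ideleNorm_det_ofFinite_eq_one_of_isCompact n K hU₀c hu₀

/-- `|det u|_𝔸 = 1` on the unipotent radicals `N_k(𝔸_K)`. [folklore] -/
theorem detNormUnit_glUnipotent {k : ℕ} (X : Multiplicative (blockNilpotent n k (AdeleRing (𝓞 K) K))) :
    detNormUnit n K (glUnipotent n k K X) = 1 := by
  refine Units.ext ?_
  rw [coe_detNormUnit, GLn.det_glUnipotent, map_one, Units.val_one]

/-- `|det u|_𝔸 = 1` for upper unitriangular `u`. [folklore] -/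
theorem detNormUnit_eq_one_of_mem_upperUnitriangular {u : GL (Fin n) (AdeleRing (𝓞 K) K)}
    (hu : u ∈ upperUnitriangular (Fin n) (AdeleRing (𝓞 K) K)) : detNormUnit n K u = 1 := by
  refine Units.ext ?_
  rw [coe_detNormUnit, det_eq_one_of_mem_upperUnitriangular hu, map_one, Units.val_one]

/-- **`|det k|_𝔸 = 1` on `K_∞`** (orthogonal / unitary matrices have determinants of modulus one at
every infinite place). [folklore] -/
theorem detNormUnit_ofInfinite_eq_one_of_mem_Kinf {k : GL (Fin n) (mixedSpace K)} (hk : k ∈ Kinf n K) :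
    detNormUnit n K (GLn.ofInfinite n K k) = 1 := by
  refine Units.ext (NNReal.coe_injective ?_)
  rw [coe_coe_detNormUnit, Units.val_one, NNReal.coe_one, ideleNorm_det_ofInfinite, mixedEmbedding.norm_apply]
  rw [mem_Kinf_iff] at hk
  have hw : ∀ w : InfinitePlace K, normAtPlace w ((k : Matrix (Fin n) (Fin n) (mixedSpace K)).det) = 1 := by
    intro w
    by_cases hwr : w.IsReal
    · rw [normAtPlace_apply_of_isReal hwr]
      have hmem := Matrix.det_of_mem_unitary ((mem_unitarySubgroupGL_iff_coe_mem_unitaryGroup _).1 (hk.1 ⟨w, hwr⟩))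
      have e : ((k : Matrix (Fin n) (Fin n) (mixedSpace K)).det).1 ⟨w, hwr⟩ =
          ((Matrix.GeneralLinearGroup.map (mixedSpaceEvalReal K ⟨w, hwr⟩) k : GL (Fin n) ℝ) : Matrix (Fin n) (Fin n) ℝ).det := by
        change (mixedSpaceEvalReal K ⟨w, hwr⟩) ((k : Matrix (Fin n) (Fin n) (mixedSpace K)).det) = _
        rw [RingHom.map_det]; rfl
      rw [e]
      exact CStarRing.norm_of_mem_unitary hmem
    · have hwc : w.IsComplex := not_isReal_iff_isComplex.1 hwr
      rw [normAtPlace_apply_of_isComplex hwc]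
      have hmem := Matrix.det_of_mem_unitary ((mem_unitarySubgroupGL_iff_coe_mem_unitaryGroup _).1 (hk.2 ⟨w, hwc⟩))
      have e : ((k : Matrix (Fin n) (Fin n) (mixedSpace K)).det).2 ⟨w, hwc⟩ =
          ((Matrix.GeneralLinearGroup.map (mixedSpaceEvalComplex K ⟨w, hwc⟩) k : GL (Fin n) ℂ) : Matrix (Fin n) (Fin n) ℂ).det := by
        change (mixedSpaceEvalComplex K ⟨w, hwc⟩) ((k : Matrix (Fin n) (Fin n) (mixedSpace K)).det) = _
        rw [RingHom.map_det]; rfl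
      rw [e]
      exact CStarRing.norm_of_mem_unitary hmem
  simp only [hw, one_pow, Finset.prod_const_one]

variable (n K)

/-- **The `A_G`-coordinate relative to `x₀`**: `a_{x₀}(g) = (|det g|_𝔸 / |det x₀|_𝔸)^{1/(n[K:ℚ])} ∈ ℝ_{>0}`,
the unique `a ∈ A_G` with `|det (g a⁻¹)| = |det x₀|` (for `n ≥ 1`). [cite: MoeglinWaldspurger1995, I.2.3] -/
def sliceScale (x₀ g : GL (Fin n) (AdeleRing (𝓞 K) K)) : ℝ≥0ˣ :=
  Units.mk0 ((((detNormUnit n K g * (detNormUnit n K x₀)⁻¹ : ℝ≥0ˣ) : ℝ≥0)) ^ (1 / ((n : ℝ) * Module.finrank ℚ K)))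
    (by
      rw [Ne, NNReal.rpow_eq_zero_iff, not_and_or]
      exact Or.inl (Units.ne_zero _))

/-- **The retraction onto the slice**: `r_{x₀}(g) = g · a_{x₀}(g)⁻¹`. [cite: MoeglinWaldspurger1995, I.2.3] -/
def sliceRetraction (x₀ g : GL (Fin n) (AdeleRing (𝓞 K) K)) : GL (Fin n) (AdeleRing (𝓞 K) K) :=
  g * (posRealScalar n K (sliceScale n K x₀ g))⁻¹

/-- **The `A_G`-invariant extension off the slice**: `φ♭ = φ ∘ r_{x₀}`. [cite: MoeglinWaldspurger1995, I.2.3] -/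
def sliceExtend (x₀ : GL (Fin n) (AdeleRing (𝓞 K) K)) (φ : GL (Fin n) (AdeleRing (𝓞 K) K) → ℂ) :
    GL (Fin n) (AdeleRing (𝓞 K) K) → ℂ :=
  φ ∘ sliceRetraction n K x₀

variable {n K}

/-- Unfolding of `sliceScale`. [folklore] -/
theorem coe_sliceScale (x₀ g : GL (Fin n) (AdeleRing (𝓞 K) K)) :
    ((sliceScale n K x₀ g : ℝ≥0ˣ) : ℝ≥0) =
      (((detNormUnit n K g * (detNormUnit n K x₀)⁻¹ : ℝ≥0ˣ) : ℝ≥0)) ^ (1 / ((n : ℝ) * Module.finrank ℚ K)) := rfl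

/-- Unfolding of `sliceRetraction`. [folklore] -/
theorem sliceRetraction_def (x₀ g : GL (Fin n) (AdeleRing (𝓞 K) K)) :
    sliceRetraction n K x₀ g = g * (posRealScalar n K (sliceScale n K x₀ g))⁻¹ := rfl

/-- Unfolding of `sliceExtend`. [folklore] -/
theorem sliceExtend_apply (x₀ : GL (Fin n) (AdeleRing (𝓞 K) K)) (φ : GL (Fin n) (AdeleRing (𝓞 K) K) → ℂ)
    (g : GL (Fin n) (AdeleRing (𝓞 K) K)) : sliceExtend n K x₀ φ g = φ (sliceRetraction n K x₀ g) := rfl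

/-- **Multiplicativity of the `A_G`-coordinate**: `a(g h) = a(g) · |det h|^{1/n[K:ℚ]}`, in the form
`a_{x₀}(g h) = a_{x₀}(g) · a_1(h)`. [folklore] -/
theorem sliceScale_mul (x₀ g h : GL (Fin n) (AdeleRing (𝓞 K) K)) :
    sliceScale n K x₀ (g * h) = sliceScale n K x₀ g * sliceScale n K 1 h := by
  refine Units.ext ?_
  rw [Units.val_mul, coe_sliceScale, coe_sliceScale, coe_sliceScale, map_mul, map_one, inv_one, mul_one,
    ← NNReal.mul_rpow, ← Units.val_mul]
  congr 2
  rw [mul_right_comm]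

/-- `a_{x₀}(g h) = a_{x₀}(g)` when `|det h|_𝔸 = 1`. [folklore] -/
theorem sliceScale_mul_of_detNormUnit_eq_one (x₀ g : GL (Fin n) (AdeleRing (𝓞 K) K)) {h : GL (Fin n) (AdeleRing (𝓞 K) K)}
    (hh : detNormUnit n K h = 1) : sliceScale n K x₀ (g * h) = sliceScale n K x₀ g := by
  rw [sliceScale_mul]
  have h1 : sliceScale n K 1 h = 1 := by
    refine Units.ext ?_
    rw [coe_sliceScale, hh, map_one, inv_one, mul_one, Units.val_one, NNReal.one_rpow]
  rw [h1, mul_one]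

/-- `a_{x₀}(h g) = a_{x₀}(g)` when `|det h|_𝔸 = 1`. [folklore] -/
theorem sliceScale_mul_left_of_detNormUnit_eq_one (x₀ g : GL (Fin n) (AdeleRing (𝓞 K) K)) {h : GL (Fin n) (AdeleRing (𝓞 K) K)}
    (hh : detNormUnit n K h = 1) : sliceScale n K x₀ (h * g) = sliceScale n K x₀ g := by
  refine Units.ext ?_
  rw [coe_sliceScale, coe_sliceScale, map_mul, hh, one_mul]

/-- `a_1(a) = a` on `A_G` (`n ≥ 1`): the `A_G`-coordinate of a positive real scalar. [folklore] -/
theorem sliceScale_one_posRealScalar [NeZero n] (t : ℝ≥0ˣ) : sliceScale n K 1 (posRealScalar n K t) = t := by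
  have hnd : ((n : ℝ) * Module.finrank ℚ K) ≠ 0 := by
    have h1 : (0 : ℝ) < n := by exact_mod_cast Nat.pos_of_ne_zero (NeZero.ne n)
    have h2 : (0 : ℝ) < Module.finrank ℚ K := by exact_mod_cast Module.finrank_pos
    positivity
  refine Units.ext ?_
  rw [coe_sliceScale, map_one, inv_one, mul_one, detNormUnit_posRealScalar, Units.val_pow_eq_pow_val,
    ← NNReal.rpow_natCast, ← NNReal.rpow_mul, Nat.cast_mul, mul_one_div_cancel hnd, NNReal.rpow_one]

/-- **`r(g h) = r(g) h` if `|det h|_𝔸 = 1`.** [folklore] -/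
theorem sliceRetraction_mul_of_detNormUnit_eq_one (x₀ g : GL (Fin n) (AdeleRing (𝓞 K) K)) {h : GL (Fin n) (AdeleRing (𝓞 K) K)}
    (hh : detNormUnit n K h = 1) : sliceRetraction n K x₀ (g * h) = sliceRetraction n K x₀ g * h := by
  rw [sliceRetraction_def, sliceRetraction_def, sliceScale_mul_of_detNormUnit_eq_one x₀ g hh, mul_assoc, mul_assoc]
  congr 1
  have hc : Commute h (posRealScalar n K (sliceScale n K x₀ g)) :=
    (Subgroup.mem_center_iff.1 (posRealScalar_mem_center n K _)) h
  exact hc.inv_right.eq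

/-- **`r(h g) = h r(g)` if `|det h|_𝔸 = 1`.** [folklore] -/
theorem sliceRetraction_mul_left_of_detNormUnit_eq_one (x₀ g : GL (Fin n) (AdeleRing (𝓞 K) K)) {h : GL (Fin n) (AdeleRing (𝓞 K) K)}
    (hh : detNormUnit n K h = 1) : sliceRetraction n K x₀ (h * g) = h * sliceRetraction n K x₀ g := by
  rw [sliceRetraction_def, sliceRetraction_def, sliceScale_mul_left_of_detNormUnit_eq_one x₀ g hh, mul_assoc]

/-- **`r` is the identity on the slice**: `r_{x₀}(g) = g` if `|det g|_𝔸 = |det x₀|_𝔸`. [folklore] -/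
theorem sliceRetraction_eq_self_of_detNormUnit_eq {x₀ g : GL (Fin n) (AdeleRing (𝓞 K) K)}
    (hg : detNormUnit n K g = detNormUnit n K x₀) : sliceRetraction n K x₀ g = g := by
  have h1 : sliceScale n K x₀ g = 1 := by
    refine Units.ext ?_
    rw [coe_sliceScale, hg, mul_inv_cancel, Units.val_one, NNReal.one_rpow]
  rw [sliceRetraction_def, h1, map_one, inv_one, mul_one]

/-- **`A_G`-invariance of the retraction**: `r_{x₀}(a g) = r_{x₀}(g)` for `a ∈ A_G` (`n ≥ 1`). [folklore] -/
theorem sliceRetraction_posRealScalar_mul [NeZero n] (x₀ : GL (Fin n) (AdeleRing (𝓞 K) K)) (t : ℝ≥0ˣ)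
    (g : GL (Fin n) (AdeleRing (𝓞 K) K)) :
    sliceRetraction n K x₀ (posRealScalar n K t * g) = sliceRetraction n K x₀ g := by
  have hcomm : posRealScalar n K t * g = g * posRealScalar n K t :=
    ((Subgroup.mem_center_iff.1 (posRealScalar_mem_center n K t)) g).symm
  rw [hcomm, sliceRetraction_def, sliceRetraction_def, sliceScale_mul, sliceScale_one_posRealScalar, map_mul,
    _root_.mul_inv_rev, mul_assoc, mul_inv_cancel_left]

end Scale

/-! ### The extension `φ♭` -/

section Extend

variable {x₀ : GL (Fin n) (AdeleRing (𝓞 K) K)} {φ : GL (Fin n) (AdeleRing (𝓞 K) K) → ℂ}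

/-- **`φ♭ = φ` on the slice.** [folklore] -/
theorem sliceExtend_apply_of_detNormUnit_eq {g : GL (Fin n) (AdeleRing (𝓞 K) K)}
    (hg : detNormUnit n K g = detNormUnit n K x₀) : sliceExtend n K x₀ φ g = φ g := by
  rw [sliceExtend_apply, sliceRetraction_eq_self_of_detNormUnit_eq hg]

/-- **`φ♭` is `A_G`-invariant** (`n ≥ 1`). [folklore] -/
theorem sliceExtend_posRealScalar_mul [NeZero n] (t : ℝ≥0ˣ) (g : GL (Fin n) (AdeleRing (𝓞 K) K)) :
    sliceExtend n K x₀ φ (posRealScalar n K t * g) = sliceExtend n K x₀ φ g := by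
  rw [sliceExtend_apply, sliceExtend_apply, sliceRetraction_posRealScalar_mul]

/-- `φ♭` is invariant under the split component `A_G = center'`. [folklore] -/
theorem sliceExtend_center'_mul [NeZero n] (z : (AdelicGroupData.gl n K).Adelic) (hz : z ∈ (AdelicGroupData.gl n K).center')
    (g : (AdelicGroupData.gl n K).Adelic) :
    sliceExtend n K x₀ φ (z * g) = sliceExtend n K x₀ φ g := by
  obtain ⟨t, rfl⟩ := hz
  exact sliceExtend_posRealScalar_mul t g

end Extend

/-! ### The intertwining identity along the archimedean one-parameter subgroups -/

section Intertwine

/-- Group-theoretic bookkeeping for `exists_sliceRetraction_mul_glArch_expMem`. [folklore] -/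
private theorem mul_mul_inv_mul_inv_eq_of_eq {G : Type*} [Group G] {g E P a L' : G} (hexp : E * P⁻¹ = L')
    (hc : L' * a⁻¹ = a⁻¹ * L') : g * E * (P⁻¹ * a⁻¹) = g * a⁻¹ * L' := by
  rw [← mul_assoc, mul_assoc g, hexp, mul_assoc, hc, ← mul_assoc]

/-- `exp X · exp(c · 1)⁻¹ = exp (X - c · 1)` in `GL_n(K_∞)` (`1` is central). [folklore] -/
theorem coe_expMem_mul_coe_expMem_smul_one_inv (X : (archGroupGL n K).lie) (c : ℝ) :
    ((archGroupGL n K).expMem X : GL (Fin n) (mixedSpace K)) *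
        (((archGroupGL n K).expMem (c • (⟨1, trivial⟩ : (archGroupGL n K).lie)) : GL (Fin n) (mixedSpace K)))⁻¹ =
      ((archGroupGL n K).expMem (X - c • (⟨1, trivial⟩ : (archGroupGL n K).lie)) : GL (Fin n) (mixedSpace K)) := by
  have hc : Commute (X : Matrix (Fin n) (Fin n) (mixedSpace K))
      (-(((c • (⟨1, trivial⟩ : (archGroupGL n K).lie) : (archGroupGL n K).lie)) : Matrix (Fin n) (Fin n) (mixedSpace K))) := by
    rw [SetLike.val_smul]
    exact ((Commute.one_right _).smul_right _).neg_right
  rw [RealMatrixGroup.coe_expMem, RealMatrixGroup.coe_expMem, RealMatrixGroup.coe_expMem, ← expGL_neg,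
    ← expGL_add_of_commute _ _ hc, AddSubgroupClass.coe_sub, sub_eq_add_neg]

set_option maxHeartbeats 400000 in
/-- **`r(g · exp X) = r(g) · exp(X - λ(X)/(n[K:ℚ]) · 1)`**: the retraction onto the slice intertwines
the archimedean one-parameter subgroups with those of the real linear endomorphism
`L X = X - f(X) · 1` of `𝔤 = 𝔤𝔩_n(K_∞)`, `f = λ/(n[K:ℚ])`, `|det (exp X, 1)|_𝔸 = e^{λ(X)}`
(`exists_linearMap_ideleNorm_det_ofInfinite_expGL`): `f` kills brackets and `1` is central. This is
the hypothesis of `ArchPullbackCalculus`. [cite: MoeglinWaldspurger1995, I.2.3] -/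
theorem exists_sliceRetraction_mul_glArch_expMem (x₀ : GL (Fin n) (AdeleRing (𝓞 K) K)) :
    ∃ (L : (archGroupGL n K).lie →ₗ[ℝ] (archGroupGL n K).lie) (f : (archGroupGL n K).lie →ₗ[ℝ] ℝ),
      (∀ X Y : (archGroupGL n K).lie, f ⁅X, Y⁆ = 0) ∧
      (∀ X, L X = X - f X • (⟨1, trivial⟩ : (archGroupGL n K).lie)) ∧
      ∀ (g : GL (Fin n) (AdeleRing (𝓞 K) K)) (X : (archGroupGL n K).lie),
        sliceRetraction n K x₀ (g * glArch n K ((archGroupGL n K).expMem X)) =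
          sliceRetraction n K x₀ g * glArch n K ((archGroupGL n K).expMem (L X)) := by
  obtain ⟨lam, hbr, hlam⟩ := exists_linearMap_ideleNorm_det_ofInfinite_expGL n K
  set D := Module.finrank ℚ K
  -- `f = λ/(n[K:ℚ])` on `𝔤`, and `L = id - f · 1`
  obtain ⟨f, hf⟩ : ∃ f : (archGroupGL n K).lie →ₗ[ℝ] ℝ,
      f = (1 / ((n : ℝ) * D)) • lam.comp (archGroupGL n K).lie.toSubmodule.subtype := ⟨_, rfl⟩
  have hf_apply : ∀ X : (archGroupGL n K).lie, f X = (1 / ((n : ℝ) * D)) * lam (X : Matrix (Fin n) (Fin n) (mixedSpace K)) :=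
    fun X => by rw [hf]; rfl
  set one : (archGroupGL n K).lie := ⟨1, trivial⟩ with hone
  obtain ⟨L, hL⟩ : ∃ L : (archGroupGL n K).lie →ₗ[ℝ] (archGroupGL n K).lie, ∀ X, L X = X - f X • one :=
    ⟨LinearMap.id - f.smulRight one, fun X => rfl⟩
  refine ⟨L, f, fun X Y => ?_, hL, fun g X => ?_⟩
  · rw [hf_apply, LieSubalgebra.coe_bracket, LieRing.of_associative_ring_bracket, hbr, mul_zero]
  · -- `|det (exp X, 1)| = e^{λ X}`, so the `A_G`-coordinate of `(exp X, 1)` is `e^{f X}`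
    have hdet : GaloisRepresentations.ideleNorm (Matrix.GeneralLinearGroup.det (glArch n K ((archGroupGL n K).expMem X))) =
        Real.exp (lam (X : Matrix (Fin n) (Fin n) (mixedSpace K))) := hlam _
    have hs : (((sliceScale n K 1 (glArch n K ((archGroupGL n K).expMem X)) : ℝ≥0ˣ) : ℝ≥0) : ℝ) = Real.exp (f X) := by
      rw [coe_sliceScale, map_one, inv_one, mul_one, NNReal.coe_rpow, coe_coe_detNormUnit, hdet, hf_apply, ← Real.exp_mul,
        mul_comm (lam (X : Matrix (Fin n) (Fin n) (mixedSpace K))) (1 / ((n : ℝ) * D))]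
    have hp : posRealScalar n K (sliceScale n K 1 (glArch n K ((archGroupGL n K).expMem X))) =
        glArch n K ((archGroupGL n K).expMem (f X • one)) := by
      rw [posRealScalar_eq_ofArch_expMem (hcpt := isCompact_glFiniteIntegralLevel_holds n K), hs, Real.log_exp]
      rfl
    -- `exp X · exp(f X · 1)⁻¹ = exp (X - f X · 1)` in `GL_n(𝔸_K)`
    have hexp : glArch n K ((archGroupGL n K).expMem X) * (glArch n K ((archGroupGL n K).expMem (f X • one)))⁻¹ =
        glArch n K ((archGroupGL n K).expMem (L X)) := by
      rw [← map_inv, ← map_mul, hL X]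
      exact congrArg (glArch n K) (Subtype.ext (coe_expMem_mul_coe_expMem_smul_one_inv X (f X)))
    -- `a(g)⁻¹` is central
    have hc1 : glArch n K ((archGroupGL n K).expMem (L X)) * (posRealScalar n K (sliceScale n K x₀ g))⁻¹ =
        (posRealScalar n K (sliceScale n K x₀ g))⁻¹ * glArch n K ((archGroupGL n K).expMem (L X)) :=
      Subgroup.mem_center_iff.1 (Subgroup.inv_mem _ (posRealScalar_mem_center n K (sliceScale n K x₀ g))) _
    -- the group identity
    rw [sliceRetraction_def, sliceRetraction_def, sliceScale_mul x₀ g, map_mul, _root_.mul_inv_rev, hp]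
    exact mul_mul_inv_mul_inv_eq_of_eq hexp hc1

end Intertwine

/-! ### `φ♭` is a cusp form if `φ` is -/

section CuspForm

variable {hcpt : isCompact_glFiniteIntegralLevel n K}

/-- **The `A_G`-invariant extension of a cusp form off a determinant slice is a cusp form**
(`n ≥ 1`): conditions (a)–(d) of Borel–Jacquet (1979), 4.2 and the cusp conditions 4.4 for
`φ♭ = φ ∘ r_{x₀}`. Left invariance and the level: `|det γ|_𝔸 = 1` (product formula) and `|det u|_𝔸 = 1`
on levels, so `r(γ g u) = γ r(g) u`. Smoothness, `K_∞`- and `Z(𝔤)`-finiteness: `ArchPullbackCalculus`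
with the intertwining identity `exists_sliceRetraction_mul_glArch_expMem` (`|det k|_𝔸 = 1` on `K_∞`).
Moderate growth: `‖r(g)‖ ≤ C ‖g‖ ‖a(g)⁻¹‖` and `‖a‖ ≤ a ⊔ a⁻¹` on `A_G` with
`a(g)^{±1} ≤ C (1 ⊔ ‖g‖)^r` (`exists_ideleNorm_det_rpow_le_height`). Cuspidality: `r(u g) = u r(g)` for
`u` unipotent. (Moeglin–Waldspurger (1995), I.2.3, I.3.2: forms on `G(𝔸)` vs. `A_G \ G(𝔸)`.)
[cite: BorelJacquet1979, 4.2 and 4.4] -/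
theorem isCuspFormGL_sliceExtend [NeZero n] {φ : GL (Fin n) (AdeleRing (𝓞 K) K) → ℂ}
    (hφ : IsCuspFormGL n K hcpt φ) (x₀ : GL (Fin n) (AdeleRing (𝓞 K) K)) :
    IsCuspFormGL n K hcpt (sliceExtend n K x₀ φ) := by
  haveI : FiniteDimensional ℝ (mixedSpace K) := inferInstance
  obtain ⟨L, f, hfbr, hL, hr⟩ := exists_sliceRetraction_mul_glArch_expMem (n := n) (K := K) x₀
  have hsm : IsArchSmooth (glArch n K) φ := hφ.1.archSmooth
  refine ⟨⟨?_, ?_, ?_, ?_, ?_, ?_⟩, ?_⟩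
  · -- (a) left invariance
    rintro (γ : GL (Fin n) (AdeleRing (𝓞 K) K)) hγ (g : GL (Fin n) (AdeleRing (𝓞 K) K))
    have e : sliceRetraction n K x₀ (γ * g) = γ * sliceRetraction n K x₀ g :=
      sliceRetraction_mul_left_of_detNormUnit_eq_one x₀ g (detNormUnit_eq_one_of_mem_arithmeticSubgroup hγ)
    change φ (sliceRetraction n K x₀ (γ * g)) = φ (sliceRetraction n K x₀ g)
    rw [e]
    exact hφ.1.leftInvariant γ hγ _
  · -- (a) level
    obtain ⟨U, hU, hUφ⟩ := hφ.1.exists_level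
    refine ⟨U, hU, ?_⟩
    rintro (u : GL (Fin n) (AdeleRing (𝓞 K) K)) hu (g : GL (Fin n) (AdeleRing (𝓞 K) K))
    have hU' : U ∈ finiteLevelsGL n K := hU
    have e : sliceRetraction n K x₀ (g * u) = sliceRetraction n K x₀ g * u :=
      sliceRetraction_mul_of_detNormUnit_eq_one x₀ g (detNormUnit_eq_one_of_mem_finiteLevelsGL hU' hu)
    change φ (sliceRetraction n K x₀ (g * u)) = φ (sliceRetraction n K x₀ g)
    rw [e]
    exact hUφ u hu _
  · -- (b) smoothness
    exact hsm.comp_of_intertwine (glArch n K) hr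
  · -- (b) `K_∞`-finiteness
    have hk : IsKFinite (glArch n K) φ := hφ.1.kFinite
    refine IsKFinite.comp_of_commute (glArch n K) (fun g k => ?_) hk
    exact sliceRetraction_mul_of_detNormUnit_eq_one x₀ g (detNormUnit_ofInfinite_eq_one_of_mem_Kinf k.2)
  · -- (c) `Z(𝔤)`-finiteness
    have hz : IsZFinite (glArch n K) φ := hφ.1.zFinite
    exact IsZFinite.comp_of_intertwine (glArch n K) hr
      (lie_one_eq_zero (hcpt := isCompact_glFiniteIntegralLevel_holds n K)) hfbr hL hsm hz
  · -- (d) moderate growth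
    obtain ⟨C₀, k₀, hC₀⟩ := hφ.1.moderateGrowth
    obtain ⟨C₁, hC₁⟩ := adelicHeightGL_mul_le_holds (n := n) (K := K)
    set D := Module.finrank ℚ K with hD
    obtain ⟨C₂, r₂, hC₂pos, hC₂⟩ := exists_ideleNorm_det_rpow_le_height (n := n) (K := K) (1 / ((n : ℝ) * D))
    obtain ⟨C₃, r₃, hC₃pos, hC₃⟩ := exists_ideleNorm_det_rpow_le_height (n := n) (K := K) (-(1 / ((n : ℝ) * D)))
    have hH : ∀ g : GL (Fin n) (AdeleRing (𝓞 K) K), 0 < adelicHeightGL n K g := fun g => adelicHeightGL_pos_holds g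
    -- the constants `A = |det x₀|^{1/nD}` and their positivity
    set A : ℝ := ((((detNormUnit n K x₀ : ℝ≥0ˣ) : ℝ≥0) : ℝ)) ^ (1 / ((n : ℝ) * D)) with hA
    have hNpos : ∀ g : GL (Fin n) (AdeleRing (𝓞 K) K), (0 : ℝ) < (((detNormUnit n K g : ℝ≥0ˣ) : ℝ≥0) : ℝ) := fun g =>
      NNReal.coe_pos.2 (pos_iff_ne_zero.2 (Units.ne_zero _))
    have hApos : 0 < A := Real.rpow_pos_of_pos (hNpos x₀) _
    have hC₀0 : 0 ≤ C₀ := by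
      have h := hC₀ 1
      have h1 : (0 : ℝ) < (1 ⊔ (AutomorphyDatum.gl n K hcpt).height 1) ^ k₀ := pow_pos (lt_of_lt_of_le one_pos le_sup_left) _
      exact nonneg_of_mul_nonneg_left ((norm_nonneg _).trans h) h1
    have hC₁0 : 0 ≤ C₁ := by
      have h := hC₁ 1 1
      rw [mul_one] at h
      have h1 : 0 < adelicHeightGL n K 1 := hH 1
      nlinarith [h1, mul_pos h1 h1]
    -- the bound on `a(g) ⊔ a(g)⁻¹`
    set C₄ : ℝ := A⁻¹ * C₂ + A * C₃ with hC₄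
    set r₄ : ℕ := max r₂ r₃ with hr₄
    have hscale : ∀ g : GL (Fin n) (AdeleRing (𝓞 K) K),
        (((sliceScale n K x₀ g : ℝ≥0ˣ) : ℝ≥0) : ℝ) ⊔ ((((sliceScale n K x₀ g : ℝ≥0ˣ) : ℝ≥0) : ℝ))⁻¹ ≤
          C₄ * (1 ⊔ adelicHeightGL n K g) ^ r₄ := by
      intro g
      have h1 : (1 : ℝ) ≤ 1 ⊔ adelicHeightGL n K g := le_sup_left
      have hs : (((sliceScale n K x₀ g : ℝ≥0ˣ) : ℝ≥0) : ℝ) =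
          GaloisRepresentations.ideleNorm (Matrix.GeneralLinearGroup.det g) ^ (1 / ((n : ℝ) * D)) * A⁻¹ := by
        rw [coe_sliceScale, NNReal.coe_rpow, Units.val_mul, NNReal.coe_mul, Units.val_inv_eq_inv_val, NNReal.coe_inv,
          Real.mul_rpow (NNReal.coe_nonneg _) (inv_nonneg.2 (NNReal.coe_nonneg _)), Real.inv_rpow (NNReal.coe_nonneg _),
          coe_coe_detNormUnit, hA]
      have hs' : ((((sliceScale n K x₀ g : ℝ≥0ˣ) : ℝ≥0) : ℝ))⁻¹ =
          GaloisRepresentations.ideleNorm (Matrix.GeneralLinearGroup.det g) ^ (-(1 / ((n : ℝ) * D))) * A := by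
        rw [hs, mul_inv, inv_inv, Real.rpow_neg (by rw [← coe_coe_detNormUnit]; exact (hNpos g).le)]
      refine sup_le ?_ ?_
      · rw [hs]
        calc GaloisRepresentations.ideleNorm (Matrix.GeneralLinearGroup.det g) ^ (1 / ((n : ℝ) * D)) * A⁻¹
            ≤ C₂ * (1 ⊔ adelicHeightGL n K g) ^ r₂ * A⁻¹ :=
              mul_le_mul_of_nonneg_right (hC₂ g) (inv_nonneg.2 hApos.le)
          _ = A⁻¹ * C₂ * (1 ⊔ adelicHeightGL n K g) ^ r₂ := by ring
          _ ≤ A⁻¹ * C₂ * (1 ⊔ adelicHeightGL n K g) ^ r₄ :=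
              mul_le_mul_of_nonneg_left (pow_le_pow_right₀ h1 (le_max_left _ _)) (by positivity)
          _ ≤ C₄ * (1 ⊔ adelicHeightGL n K g) ^ r₄ := by
              refine mul_le_mul_of_nonneg_right ?_ (by positivity)
              rw [hC₄]; linarith [mul_pos hApos hC₃pos]
      · rw [hs']
        calc GaloisRepresentations.ideleNorm (Matrix.GeneralLinearGroup.det g) ^ (-(1 / ((n : ℝ) * D))) * A
            ≤ C₃ * (1 ⊔ adelicHeightGL n K g) ^ r₃ * A := mul_le_mul_of_nonneg_right (hC₃ g) hApos.le
          _ = A * C₃ * (1 ⊔ adelicHeightGL n K g) ^ r₃ := by ring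
          _ ≤ A * C₃ * (1 ⊔ adelicHeightGL n K g) ^ r₄ :=
              mul_le_mul_of_nonneg_left (pow_le_pow_right₀ h1 (le_max_right _ _)) (by positivity)
          _ ≤ C₄ * (1 ⊔ adelicHeightGL n K g) ^ r₄ := by
              refine mul_le_mul_of_nonneg_right ?_ (by positivity)
              rw [hC₄]; linarith [mul_pos (inv_pos.2 hApos) hC₂pos]
    have hC₄0 : 0 ≤ C₄ := by rw [hC₄]; positivity
    -- the height of `r(g)`
    have hheight : ∀ g : GL (Fin n) (AdeleRing (𝓞 K) K),
        1 ⊔ adelicHeightGL n K (sliceRetraction n K x₀ g) ≤ (1 ⊔ C₁ * C₄) * (1 ⊔ adelicHeightGL n K g) ^ (r₄ + 1) := by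
      intro g
      have h1 : (1 : ℝ) ≤ 1 ⊔ adelicHeightGL n K g := le_sup_left
      have h2 := hC₁ g (posRealScalar n K (sliceScale n K x₀ g))⁻¹
      rw [adelicHeightGL_inv] at h2
      have h3 := adelicHeightGL_posRealScalar_le (n := n) (K := K) (sliceScale n K x₀ g)
      have h4 : adelicHeightGL n K (sliceRetraction n K x₀ g) ≤ C₁ * C₄ * (1 ⊔ adelicHeightGL n K g) ^ (r₄ + 1) := by
        rw [sliceRetraction_def]
        calc adelicHeightGL n K (g * (posRealScalar n K (sliceScale n K x₀ g))⁻¹)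
            ≤ C₁ * adelicHeightGL n K g * adelicHeightGL n K (posRealScalar n K (sliceScale n K x₀ g)) := h2
          _ ≤ C₁ * (1 ⊔ adelicHeightGL n K g) * (C₄ * (1 ⊔ adelicHeightGL n K g) ^ r₄) :=
              mul_le_mul (mul_le_mul_of_nonneg_left le_sup_right hC₁0) (h3.trans (hscale g)) (hH _).le (by positivity)
          _ = C₁ * C₄ * (1 ⊔ adelicHeightGL n K g) ^ (r₄ + 1) := by ring
      refine sup_le ?_ (h4.trans ?_)
      · calc (1 : ℝ) ≤ 1 * 1 := by rw [mul_one]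
          _ ≤ (1 ⊔ C₁ * C₄) * (1 ⊔ adelicHeightGL n K g) ^ (r₄ + 1) :=
              mul_le_mul le_sup_left (one_le_pow₀ h1) zero_le_one (by positivity)
      · exact mul_le_mul_of_nonneg_right le_sup_right (by positivity)
    refine ⟨C₀ * (1 ⊔ C₁ * C₄) ^ k₀, (r₄ + 1) * k₀, fun g => ?_⟩
    have h := hC₀ (sliceRetraction n K x₀ g)
    rw [AutomorphyDatum.gl_height] at h ⊢
    change ‖φ (sliceRetraction n K x₀ g)‖ ≤ _
    calc ‖φ (sliceRetraction n K x₀ g)‖ ≤ C₀ * (1 ⊔ adelicHeightGL n K (sliceRetraction n K x₀ g)) ^ k₀ := h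
      _ ≤ C₀ * ((1 ⊔ C₁ * C₄) * (1 ⊔ adelicHeightGL n K g) ^ (r₄ + 1)) ^ k₀ :=
          mul_le_mul_of_nonneg_left (pow_le_pow_left₀ (le_trans zero_le_one le_sup_left) (hheight g) k₀) hC₀0
      _ = C₀ * (1 ⊔ C₁ * C₄) ^ k₀ * (1 ⊔ adelicHeightGL n K g) ^ ((r₄ + 1) * k₀) := by rw [mul_pow, pow_mul]; ring
  · -- cusp conditions
    intro k hk hkn ν _ 𝓕 h𝓕 g
    set g' : (AdelicGroupData.gl n K).Adelic := sliceRetraction n K x₀ g with hg'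
    have h := hφ.2 k hk hkn ν 𝓕 h𝓕 g'
    have e : (fun X : blockNilpotent n k (AdeleRing (𝓞 K) K) =>
        sliceExtend n K x₀ φ (glUnipotent n k K (Multiplicative.ofAdd X) * g)) =
        fun X => φ (glUnipotent n k K (Multiplicative.ofAdd X) * g') := by
      funext X
      have e1 : sliceRetraction n K x₀ (glUnipotent n k K (Multiplicative.ofAdd X) * g) =
          glUnipotent n k K (Multiplicative.ofAdd X) * g' :=
        sliceRetraction_mul_left_of_detNormUnit_eq_one x₀ g (detNormUnit_glUnipotent _)
      exact congrArg φ e1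
    change IntegrableOn (fun X : blockNilpotent n k (AdeleRing (𝓞 K) K) =>
        sliceExtend n K x₀ φ (glUnipotent n k K (Multiplicative.ofAdd X) * g)) 𝓕 ν ∧
      ∫ X in 𝓕, sliceExtend n K x₀ φ (glUnipotent n k K (Multiplicative.ofAdd X) * g) ∂ν = 0
    rw [e]
    exact h

end CuspForm

/-! ### The Whittaker tower of `φ♭` on the slice -/

section Whittaker

variable [MeasurableSpace (GL (Fin n) (AdeleRing (𝓞 K) K))] [BorelSpace (GL (Fin n) (AdeleRing (𝓞 K) K))]

/-- **The partial Whittaker transforms of `φ♭` and `φ` agree on the slice**: if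
`|det z|_𝔸 = |det x₀|_𝔸` then `whittakerIter k (φ♭) z = whittakerIter k φ z` (the column variables are
unipotent, of determinant one, so the integrands stay on the slice). [folklore] -/
theorem whittakerIter_sliceExtend_eq (x₀ : GL (Fin n) (AdeleRing (𝓞 K) K)) (φ : GL (Fin n) (AdeleRing (𝓞 K) K) → ℂ) :
    ∀ (k : ℕ) {z : GL (Fin n) (AdeleRing (𝓞 K) K)}, detNormUnit n K z = detNormUnit n K x₀ →
      whittakerIter (K := K) k (sliceExtend n K x₀ φ) z = whittakerIter (K := K) k φ z
  | 0, z, hz => sliceExtend_apply_of_detNormUnit_eq hz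
  | k + 1, z, hz => by
    by_cases h : n - (k + 1) < n ∧ 0 < n - (k + 1)
    · simp only [whittakerIter, dif_pos h]
      rw [colTransform_eq, colTransform_eq]
      congr 1
      refine setIntegral_congr_fun measurableSet_colRangeTateDomain fun y _ => ?_
      unfold colIntegrand
      congr 1
      refine whittakerIter_sliceExtend_eq x₀ φ k ?_
      rw [map_mul, hz, detNormUnit_eq_one_of_mem_upperUnitriangular (unipotentColRange_le_upperUnitriangular y.2), one_mul]
    · simp only [whittakerIter, dif_neg h]
      exact whittakerIter_sliceExtend_eq x₀ φ k hz

/-- **`Φ_d(φ♭) = Φ_d(φ)` on the slice.** [folklore] -/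
theorem whittakerDepth_sliceExtend_eq (x₀ : GL (Fin n) (AdeleRing (𝓞 K) K)) (φ : GL (Fin n) (AdeleRing (𝓞 K) K) → ℂ)
    (d : ℕ) {z : GL (Fin n) (AdeleRing (𝓞 K) K)} (hz : detNormUnit n K z = detNormUnit n K x₀) :
    whittakerDepth (K := K) d (sliceExtend n K x₀ φ) z = whittakerDepth (K := K) d φ z :=
  whittakerIter_sliceExtend_eq x₀ φ _ hz

end Whittaker

end Literature.NumberTheory.Automorphic
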